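import Literature.GroupTheory.CombinatorialGroupTheory.RandomSclFreeGroupProofs
import Mathlib.Data.Prod.Lex
import Mathlib.Order.Interval.Finset.Nat
import HarnessLib

/-!
# Random rigidity of scl (Calegari–Walker 2013): proofs, part 23 — overlap accounting for
families of blocks ("Lemma O")

D. Calegari, A. Walker, *Random rigidity in the free group*, Geom. Topol. 17 (2013)
[CalegariWalker2013], §4.6 (Lemmas 4.13–4.14): the total overlap of the windows of a comb
configuration, counted with multiplicity, is controlled by the number of *pinned* blocks (blocks
that meet a block starting to their left), each pin contributing at most the maximal pairwise
overlap. Together with `card_filter_constraints_le` this is the rank bound behind Lemma 4.14.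

* **`card_Ico_inter_blocks_le`** — two blocks `[p − κL, p + λ + κR)` whose middle parts
  `[p, p + λ)` meet in `< g` points and whose flanks are `≤ ℓmax` meet in `≤ 2ℓmax + g` points.
* **`sum_len_le_card_biUnion_add`** — `Σ_t |block_t| ≤ |⋃ block_t| + Bpair · #pinned`.
* **`card_filter_pinned_eq_le`** — placements with a prescribed pinned set `S` number at most
  `n^{B−|S|} (B·Lmax)^{|S|}`.
-/

namespace Literature.GroupTheory.CombinatorialGroupTheory

section BlockOverlap

open Finset

open scoped Classical

/-- **Pairwise overlap of admissible blocks.** If the middle parts `[pᵢ, pᵢ + λᵢ)`, `[pⱼ, pⱼ + λⱼ)`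
of two blocks meet in fewer than `g` points and all four flanks have length `≤ ℓmax`, the blocks
`[pᵢ − κLᵢ, pᵢ + λᵢ + κRᵢ)`, `[pⱼ − κLⱼ, pⱼ + λⱼ + κRⱼ)` meet in at most `2ℓmax + g` points.
[cite: CalegariWalker2013, §4.6 (two subwords contribute at most `2(1+δ)` to `P′`)] -/
theorem card_Ico_inter_blocks_le {pi pj li lj κLi κRi κLj κRj ℓmax g : ℕ}
    (hLi : κLi ≤ ℓmax) (hRi : κRi ≤ ℓmax) (hLj : κLj ≤ ℓmax) (hRj : κRj ≤ ℓmax)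
    (hD : (Finset.Ico pi (pi + li) ∩ Finset.Ico pj (pj + lj)).card < g) :
    (Finset.Ico (pi - κLi) (pi + li + κRi) ∩ Finset.Ico (pj - κLj) (pj + lj + κRj)).card ≤
      2 * ℓmax + g := by
  rw [Finset.Ico_inter_Ico, Nat.card_Ico] at hD ⊢
  omega

/-- **Lemma O: total overlap versus pins.** Let `block_t = [l_t, r_t)` (`t : Fin B`) be intervals
such that any two distinct blocks that meet do so in at most `Bpair` points. Call `t` *pinned* if
it meets a block `u ≠ t` with `(l_u, u) <_lex (l_t, t)`. Then
`Σ_t |block_t| ≤ |⋃_t block_t| + Bpair · #{t pinned}`.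
[cite: CalegariWalker2013, Lemma 4.14 (mechanism)] -/
theorem sum_len_le_card_biUnion_add {B : ℕ} (l r : Fin B → ℕ) (Bpair : ℕ)
    (hpair : ∀ t u : Fin B, t ≠ u → (Finset.Ico (l t) (r t) ∩ Finset.Ico (l u) (r u)).Nonempty →
      (Finset.Ico (l t) (r t) ∩ Finset.Ico (l u) (r u)).card ≤ Bpair) :
    ∑ t : Fin B, (r t - l t) ≤
      (Finset.univ.biUnion fun t : Fin B => Finset.Ico (l t) (r t)).card +
        Bpair * (Finset.univ.filter fun t : Fin B => ∃ u : Fin B, u ≠ t ∧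
          (Finset.Ico (l t) (r t) ∩ Finset.Ico (l u) (r u)).Nonempty ∧
          (l u < l t ∨ (l u = l t ∧ u < t))).card := by
  -- the statement for every subfamily `S`, by induction on `#S`
  suffices h : ∀ (c : ℕ) (S : Finset (Fin B)), S.card = c →
      ∑ t ∈ S, (r t - l t) ≤ (S.biUnion fun t : Fin B => Finset.Ico (l t) (r t)).card +
        Bpair * (S.filter fun t : Fin B => ∃ u ∈ S, u ≠ t ∧
          (Finset.Ico (l t) (r t) ∩ Finset.Ico (l u) (r u)).Nonempty ∧
          (l u < l t ∨ (l u = l t ∧ u < t))).card by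
    have := h _ Finset.univ rfl
    simpa using this
  intro c
  induction c with
  | zero =>
    intro S hS
    rw [Finset.card_eq_zero] at hS
    subst hS
    simp
  | succ c ih =>
    intro S hS
    have hSne : S.Nonempty := by rw [← Finset.card_pos, hS]; omega
    -- the lexicographically last block
    obtain ⟨t₀, ht₀, hmax⟩ := S.exists_max_image (fun t => toLex (l t, (t : ℕ))) hSne
    set S' := S.erase t₀ with hS'
    have hS'c : S'.card = c := by rw [hS', Finset.card_erase_of_mem ht₀, hS]; rfl
    have ih' := ih S' hS'c
    have hSeq : S = insert t₀ S' := by rw [hS', Finset.insert_erase ht₀]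
    have ht₀S' : t₀ ∉ S' := by rw [hS']; exact Finset.notMem_erase t₀ S
    -- every other block starts at or before `l t₀`
    have hle : ∀ u ∈ S', l u ≤ l t₀ := by
      intro u hu
      have hu' : u ∈ S := Finset.mem_of_mem_erase hu
      have h1 := hmax u hu'
      rw [Prod.Lex.le_iff] at h1
      simp only [ofLex_toLex] at h1
      rcases h1 with h | ⟨h, _⟩
      · exact h.le
      · exact h.le
    have hlex : ∀ u ∈ S', l u < l t₀ ∨ (l u = l t₀ ∧ u < t₀) := by
      intro u hu
      have hu' : u ∈ S := Finset.mem_of_mem_erase hu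
      have hne : u ≠ t₀ := Finset.ne_of_mem_erase hu
      have h1 := hmax u hu'
      rw [Prod.Lex.le_iff] at h1
      simp only [ofLex_toLex] at h1
      rcases h1 with h | ⟨h, h2⟩
      · exact Or.inl h
      · right
        refine ⟨h, ?_⟩
        have : (u : ℕ) ≠ t₀ := fun e => hne (Fin.ext e)
        exact Fin.lt_def.mpr (by omega)
    -- the overlap of `block t₀` with the union of the others
    set U' := S'.biUnion fun t : Fin B => Finset.Ico (l t) (r t) with hU'
    set I₀ := Finset.Ico (l t₀) (r t₀) with hI₀
    have hunion : (S.biUnion fun t : Fin B => Finset.Ico (l t) (r t)) = I₀ ∪ U' := by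
      rw [hSeq, Finset.biUnion_insert]
    have hcardU : (I₀ ∪ U').card + (I₀ ∩ U').card = I₀.card + U'.card :=
      Finset.card_union_add_card_inter I₀ U'
    -- the overlap is contained in one block `u*` and then bounded by `Bpair`
    have hov : (I₀ ∩ U').card ≤ Bpair * (if (I₀ ∩ U').Nonempty then 1 else 0) := by
      by_cases hne : (I₀ ∩ U').Nonempty
      · rw [if_pos hne, mul_one]
        -- `S'` is nonempty; take `u*` maximising `r`
        have hS'ne : S'.Nonempty := by
          obtain ⟨x, hx⟩ := hne
          rw [Finset.mem_inter, hU', Finset.mem_biUnion] at hx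
          obtain ⟨u, hu, _⟩ := hx.2
          exact ⟨u, hu⟩
        obtain ⟨us, hus, husmax⟩ := S'.exists_max_image r hS'ne
        have hsub : I₀ ∩ U' ⊆ I₀ ∩ Finset.Ico (l us) (r us) := by
          intro x hx
          rw [Finset.mem_inter, hU', Finset.mem_biUnion] at hx
          obtain ⟨hx0, u, hu, hxu⟩ := hx
          rw [Finset.mem_inter]
          refine ⟨hx0, ?_⟩
          rw [hI₀, Finset.mem_Ico] at hx0
          rw [Finset.mem_Ico] at hxu ⊢
          exact ⟨(hle us hus).trans hx0.1, lt_of_lt_of_le hxu.2 (husmax u hu)⟩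
        have hne' : (I₀ ∩ Finset.Ico (l us) (r us)).Nonempty := hne.mono hsub
        have hneq : t₀ ≠ us := fun e => ht₀S' (e ▸ hus)
        calc (I₀ ∩ U').card ≤ (I₀ ∩ Finset.Ico (l us) (r us)).card := Finset.card_le_card hsub
          _ ≤ Bpair := hpair t₀ us hneq hne'
      · rw [if_neg hne, mul_zero]
        rw [Finset.not_nonempty_iff_eq_empty] at hne
        rw [hne, Finset.card_empty]
    -- pins: those of `S'` inject, and `t₀` is pinned in `S` if the overlap is non-empty
    have hpin : (S'.filter fun t : Fin B => ∃ u ∈ S', u ≠ t ∧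
          (Finset.Ico (l t) (r t) ∩ Finset.Ico (l u) (r u)).Nonempty ∧
          (l u < l t ∨ (l u = l t ∧ u < t))).card + (if (I₀ ∩ U').Nonempty then 1 else 0) ≤
        (S.filter fun t : Fin B => ∃ u ∈ S, u ≠ t ∧
          (Finset.Ico (l t) (r t) ∩ Finset.Ico (l u) (r u)).Nonempty ∧
          (l u < l t ∨ (l u = l t ∧ u < t))).card := by
      have hsub1 : (S'.filter fun t : Fin B => ∃ u ∈ S', u ≠ t ∧
          (Finset.Ico (l t) (r t) ∩ Finset.Ico (l u) (r u)).Nonempty ∧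
          (l u < l t ∨ (l u = l t ∧ u < t))) ⊆
          (S.filter fun t : Fin B => ∃ u ∈ S, u ≠ t ∧
            (Finset.Ico (l t) (r t) ∩ Finset.Ico (l u) (r u)).Nonempty ∧
            (l u < l t ∨ (l u = l t ∧ u < t))).erase t₀ := by
        intro t ht
        rw [Finset.mem_filter] at ht
        rw [Finset.mem_erase, Finset.mem_filter]
        obtain ⟨htS', u, hu, hut, hov', hlex'⟩ := ht
        exact ⟨Finset.ne_of_mem_erase htS', Finset.mem_of_mem_erase htS', u,
          Finset.mem_of_mem_erase hu, hut, hov', hlex'⟩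
      by_cases hne : (I₀ ∩ U').Nonempty
      · rw [if_pos hne]
        have ht₀pin : t₀ ∈ (S.filter fun t : Fin B => ∃ u ∈ S, u ≠ t ∧
            (Finset.Ico (l t) (r t) ∩ Finset.Ico (l u) (r u)).Nonempty ∧
            (l u < l t ∨ (l u = l t ∧ u < t))) := by
          rw [Finset.mem_filter]
          refine ⟨ht₀, ?_⟩
          obtain ⟨x, hx⟩ := hne
          rw [Finset.mem_inter, hU', Finset.mem_biUnion] at hx
          obtain ⟨hx0, u, hu, hxu⟩ := hx
          refine ⟨u, Finset.mem_of_mem_erase hu, Finset.ne_of_mem_erase hu, ⟨x, ?_⟩, hlex u hu⟩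
          rw [Finset.mem_inter]; exact ⟨hx0, hxu⟩
        calc _ ≤ ((S.filter fun t : Fin B => ∃ u ∈ S, u ≠ t ∧
              (Finset.Ico (l t) (r t) ∩ Finset.Ico (l u) (r u)).Nonempty ∧
              (l u < l t ∨ (l u = l t ∧ u < t))).erase t₀).card + 1 :=
              Nat.add_le_add_right (Finset.card_le_card hsub1) 1
          _ = _ := by rw [Finset.card_erase_add_one ht₀pin]
      · rw [if_neg hne, add_zero]
        exact (Finset.card_le_card hsub1).trans (Finset.card_erase_le)
    -- assemble
    rw [hSeq, Finset.sum_insert ht₀S', ← hSeq, hunion]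
    have hI₀c : I₀.card = r t₀ - l t₀ := by rw [hI₀, Nat.card_Ico]
    have hmul : Bpair * (S'.filter fun t : Fin B => ∃ u ∈ S', u ≠ t ∧
          (Finset.Ico (l t) (r t) ∩ Finset.Ico (l u) (r u)).Nonempty ∧
          (l u < l t ∨ (l u = l t ∧ u < t))).card +
        Bpair * (if (I₀ ∩ U').Nonempty then 1 else 0) ≤
        Bpair * (S.filter fun t : Fin B => ∃ u ∈ S, u ≠ t ∧
          (Finset.Ico (l t) (r t) ∩ Finset.Ico (l u) (r u)).Nonempty ∧
          (l u < l t ∨ (l u = l t ∧ u < t))).card := by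
      rw [← mul_add]; exact Nat.mul_le_mul_left _ hpin
    omega

/-- **Entropy of pinned configurations.** Fix lengths `len t < Lmax` of `B` blocks placed at
`l t < n`, `block_t = [l_t, l_t + len_t)`, and a set `S` of indices. The placements `l` whose set
of pinned blocks (blocks meeting a block `u ≠ t` with `(l_u, u) <_lex (l_t, t)`) is exactly `S`
number at most `n^{B − |S|} (B · Lmax)^{|S|}`: a pinned block is determined by the block it is
pinned to and an offset `< Lmax`. [cite: CalegariWalker2013, Lemma 4.14 (counting configurations)] -/
theorem card_filter_pinned_eq_le {B n Lmax : ℕ} (len : Fin B → ℕ) (hlen : ∀ t, len t < Lmax)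
    (S : Finset (Fin B)) :
    ((Finset.univ : Finset (Fin B → Fin n)).filter fun l =>
      (Finset.univ.filter fun t : Fin B => ∃ u : Fin B, u ≠ t ∧
        (Finset.Ico (l t : ℕ) (l t + len t) ∩ Finset.Ico (l u : ℕ) (l u + len u)).Nonempty ∧
        ((l u : ℕ) < l t ∨ ((l u : ℕ) = l t ∧ u < t))) = S).card ≤
      n ^ (B - S.card) * (B * Lmax) ^ S.card := by
  -- the pin predicate
  set P : (Fin B → Fin n) → Fin B → Prop := fun l t => ∃ u : Fin B, u ≠ t ∧
      (Finset.Ico (l t : ℕ) (l t + len t) ∩ Finset.Ico (l u : ℕ) (l u + len u)).Nonempty ∧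
      ((l u : ℕ) < l t ∨ ((l u : ℕ) = l t ∧ u < t)) with hP
  set L := (Finset.univ : Finset (Fin B → Fin n)).filter fun l =>
      (Finset.univ.filter fun t : Fin B => P l t) = S with hL
  rcases Nat.eq_zero_or_pos Lmax with hL0 | hLpos
  · -- `Lmax = 0` is impossible unless `B = 0`
    rcases Nat.eq_zero_or_pos B with hB0 | hBpos
    · subst hB0
      have hS0 : S = ∅ := Finset.eq_empty_of_forall_notMem (fun t _ => t.elim0)
      subst hS0
      simp only [Finset.card_empty, Nat.sub_zero, pow_zero, mul_one]
      calc L.card ≤ (Finset.univ : Finset (Fin 0 → Fin n)).card := Finset.card_le_univ _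
        _ = 1 := by simp
    · exact absurd (hlen ⟨0, hBpos⟩) (by omega)
  -- the pin map: for a pinned `t`, a chosen smaller block meeting it
  have hchoose : ∀ (l : Fin B → Fin n) (t : Fin B), P l t → ∃ u : Fin B, u ≠ t ∧
      (Finset.Ico (l t : ℕ) (l t + len t) ∩ Finset.Ico (l u : ℕ) (l u + len u)).Nonempty ∧
      ((l u : ℕ) < l t ∨ ((l u : ℕ) = l t ∧ u < t)) := fun l t h => h
  choose! pin hpin using hchoose
  -- offsets are `< Lmax`
  have hoff : ∀ l t, P l t → (l (pin l t) : ℕ) ≤ l t ∧ (l t : ℕ) - l (pin l t) < Lmax := by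
    intro l t ht
    obtain ⟨_, hov, hlex⟩ := hpin l t ht
    have h1 : (l (pin l t) : ℕ) ≤ l t := by rcases hlex with h | ⟨h, _⟩ <;> omega
    refine ⟨h1, ?_⟩
    obtain ⟨x, hx⟩ := hov
    rw [Finset.mem_inter, Finset.mem_Ico, Finset.mem_Ico] at hx
    have := hlen (pin l t)
    omega
  -- the encoding
  let enc : (Fin B → Fin n) → (↥(Sᶜ : Finset (Fin B)) → Fin n) × (↥S → Fin B × Fin Lmax) :=
    fun l => (fun t => l t, fun t => (pin l t,
      ⟨((l t : ℕ) - l (pin l t)) % Lmax, Nat.mod_lt _ hLpos⟩))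
  have hinj : Set.InjOn enc (L : Set (Fin B → Fin n)) := by
    intro l hl l' hl' heq
    rw [Finset.mem_coe, hL, Finset.mem_filter] at hl hl'
    have hS : ∀ t, P l t ↔ t ∈ S := by
      intro t; rw [← hl.2, Finset.mem_filter]; simp
    have hS' : ∀ t, P l' t ↔ t ∈ S := by
      intro t; rw [← hl'.2, Finset.mem_filter]; simp
    simp only [enc, Prod.mk.injEq] at heq
    obtain ⟨h1, h2⟩ := heq
    have hfree : ∀ t, t ∉ S → l t = l' t := by
      intro t ht
      have := congr_fun h1 ⟨t, Finset.mem_compl.mpr ht⟩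
      exact this
    have hpinS : ∀ t, t ∈ S → pin l t = pin l' t ∧
        ((l t : ℕ) - l (pin l t)) % Lmax = ((l' t : ℕ) - l' (pin l' t)) % Lmax := by
      intro t ht
      have := congr_fun h2 ⟨t, ht⟩
      simp only [Prod.mk.injEq, Fin.mk.injEq] at this
      exact this
    -- strong induction on the lexicographic rank of `(l t, t)`
    suffices hind : ∀ (k : ℕ) (t : Fin B),
        (Finset.univ.filter fun u : Fin B =>
          (l u : ℕ) < l t ∨ ((l u : ℕ) = l t ∧ u < t)).card = k → l t = l' t by
      funext t; exact hind _ t rfl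
    intro k
    induction k using Nat.strong_induction_on with
    | _ k ih =>
      intro t hk
      by_cases ht : t ∈ S
      · have hPt : P l t := (hS t).mpr ht
        have hPt' : P l' t := (hS' t).mpr ht
        obtain ⟨hpe, hmod⟩ := hpinS t ht
        obtain ⟨hle1, hlt1⟩ := hoff l t hPt
        obtain ⟨hle2, hlt2⟩ := hoff l' t hPt'
        rw [← hpe] at hle2 hlt2 hmod
        rw [Nat.mod_eq_of_lt hlt1, Nat.mod_eq_of_lt hlt2] at hmod
        -- the pin has smaller rank
        obtain ⟨hne, _, hlex⟩ := hpin l t hPt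
        have hrank : (Finset.univ.filter fun u : Fin B =>
            (l u : ℕ) < l (pin l t) ∨ ((l u : ℕ) = l (pin l t) ∧ u < pin l t)).card < k := by
          rw [← hk]
          apply Finset.card_lt_card
          rw [Finset.ssubset_iff_of_subset]
          · refine ⟨pin l t, ?_, ?_⟩
            · rw [Finset.mem_filter]; exact ⟨Finset.mem_univ _, hlex⟩
            · rw [Finset.mem_filter]; simp
          · intro u hu
            rw [Finset.mem_filter] at hu ⊢
            refine ⟨Finset.mem_univ _, ?_⟩
            rcases hu.2 with h | ⟨h, h'⟩ <;> rcases hlex with g | ⟨g, g'⟩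
            · left; omega
            · left; omega
            · left; omega
            · right; exact ⟨by omega, h'.trans g'⟩
        have hrec := ih _ hrank (pin l t) rfl
        apply Fin.ext
        have : (l t : ℕ) = l (pin l t) + ((l t : ℕ) - l (pin l t)) := by omega
        rw [this, hmod, hrec]
        omega
      · exact hfree t ht
  -- count
  have hcard := Finset.card_le_card_of_injOn enc (fun l _ => Finset.mem_coe.mpr (Finset.mem_univ (enc l))) hinj
  refine hcard.trans ?_
  rw [Finset.card_univ, Fintype.card_prod, Fintype.card_fun, Fintype.card_fun, Fintype.card_prod,
    Fintype.card_fin, Fintype.card_fin, Fintype.card_fin, Fintype.card_coe, Fintype.card_coe,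
    Finset.card_compl, Fintype.card_fin]

end BlockOverlap

end Literature.GroupTheory.CombinatorialGroupTheory
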